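import Summits.QuantumFields.BalabanUV.Beta.DshAn1Spread
import Summits.QuantumFields.BalabanUV.Beta.RowD1JointEndSymRefl
import Summits.QuantumFields.BalabanUV.Beta.SymShiftGaugeBlind

/-!
# `DshAn1End` — an1's TYPED symmetrised border shift `Dsh`, part 3∕3: §7 the row-D1 END at an1's `Dsh Lc` with (Dspr)(Dnull) DISCHARGED (an1 gen 38), and §8 (row
# owner an2 gen 28) THE LITERAL ROOT AT an1's `Dsh Lc` WITH (St)(Wt)(Sd)(Sr-conj) DISCHARGED — every SHIFT letter (Dspr)(Dnull)(Dff)(Dmm)(DG) a THEOREM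
# ((DG) by `SymShiftGaugeBlind` from an1's (Dgrad) `Dsh_inl_inr_eq_sub` + `lam04_eq_zero_of_ne_blk` + `Dsh_inr_inl_eq_neg`), (V-d) traded for an1's (S-V)⁰⁴ by `hVd_iff`

W-supplier an1 gen 38 (§7 bytes verbatim from `HOME/b2b-balaban-beta-an1-g38/sym/DshAn1.lean` fc0da04a7a2642d2) + row owner an2 gen 28 (§8).  WHAT §8 DISPLAYS (= the
row's binder denominator at the literal with the shift TYPED; every one a hypothesis, none proved anywhere): the table record `tabs`; the TABLE letters (S-V)⁰⁴
`∀ u, divV tabs.V u = conjV (mfNeg (linSym04At ρ_c Lc)) (diagK (legInd ρ_c u))`, (V-r) on the three border leg pairs against `bhK Lc + Dsh Lc` with generator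
`(Lc⁴)⁻¹ • diagK (ctGenM 3 (bhK Lc + Dsh Lc) α Lc κ′ u)`, (V-ff0), (H-r); the second-order letters (Wd) (pinned Ward generator), (Wr-conj-c) (pinned first-order contacts
`γ j • diagK (ctGenM 3 (bhK Lc + Dsh Lc) α Lc κ u)`), `hcomp`; `D1Tel`; `D1Rep`; printed B5 `h12`∕`h126`; the window.  NO shift letter is displayed any more.
HONEST COUNT: root-level classes {hW-letters = (S-V)⁰⁴(Wd), hR-letters = (V-r)(V-ff0)(H-r)(Wr-conj-c), hcomp, D1Tel, D1Rep}: 0∕5 discharged; table VALUES 0∕5 in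
tree (an1 TABLES-SYM); NOT D1, NOT BetaPertH, NOT continuum, NOT Clay.  HONEST DEPENDENCY: continuum YM on T⁴ ⇐ BetaPertH ∧ nine spine estimates (0/9 proved);
BetaPertH ⇐ (D1) ∧ (D4) ∧ CAP+tail; G-an2-4 gates asym, D1 and NE2/3/4.  No statement of Bałaban's papers, no `[cite:]`, no `Prop` fact, no `def`.
-/

noncomputable section

open Finset Matrix
open scoped BigOperators Nat
open Literature.Probability.LatticeModels (Torus.proj)
open Literature.MathematicalPhysics.QuantumFieldTheory
open Literature.MathematicalPhysics.QuantumFieldTheory.Balaban1983to89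
open Literature.MathematicalPhysics.QuantumFieldTheory.Balaban1983to89.Beta
open B12Sec2to5 (l1 l1_nonneg)
open ExpKernelCalculus (MKer Decays comp)
open AffineAveraging (Form0 Form1 Site unitVec unitVec_apply dz box toSite contourSum)
open AffineReproduction (contourSumAdj)
open AveragingContours (blk shift off off_mem_box blk_add_off blk_block)
open AveragingContoursRooted (ctr ctrOff ctrOff_mem_box)
open AxialProjector (zsmul_blk_le lt_zsmul_blk_add blk_add_zsmul)
open KKTFluctuationKernel (delta1 delta1_apply)
open LatticeForm (quo)
open OneStepResolventKernel (Fib quo_zsmul eq_zsmul_quo_of_proj proj_zsmul)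
open Summit.QuantumFields.BalabanUV.Beta.TameKernelCalculus
open Summit.QuantumFields.BalabanUV.Beta.AxialDressingRooted (cube mem_cube l1_le_of_mem_cube one_le_of_neZero)
open Summit.QuantumFields.BalabanUV.Beta.SymmetrisedAxialPotential
open Summit.QuantumFields.BalabanUV.Beta.SymmetrisedAxialGauge
open Summit.QuantumFields.BalabanUV.Beta.SymmetrisedDressingMatrix
open Summit.QuantumFields.BalabanUV.Beta.KernelOrthoProjector
open Summit.QuantumFields.BalabanUV.Beta.SymSliceBlockMatrix
open Summit.QuantumFields.BalabanUV.Beta.SymSliceProjectorKernel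
open Summit.QuantumFields.BalabanUV.Beta.SymSliceProjectorRules (comp_symEc_apply_inr comp_symEc_apply_inl_of_not_int comp_symEc_apply_inl_of_int)
open Summit.QuantumFields.BalabanUV.Beta.SymSliceProjectorFixed (isIntBond_of_blk_add_unitVec symTreeGaugeAt_bondIndR_of_not_int Gmat_mulVec_Pmat_row)
open Summit.QuantumFields.BalabanUV.Beta.SymGaugeMultiplierBlockMean (bondIndR_eq_delta1)
open Summit.QuantumFields.BalabanUV.Beta.BorderedHessian (bhK bhK_inl_inl bhK_inl_inr bhK_inr_inl bhK_inr_inr off_eq_zero_iff_proj blk_eq_quo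
  cube_mono contourSum_delta1_eq_contourSumAdj)
open Summit.QuantumFields.BalabanUV.Beta.WardLocusStencils (ffK ffK_inl_inl ffK_inl_inr ffK_inr_inl ffK_inr_inr)

namespace Summit.QuantumFields.BalabanUV.Beta.DshAn1

variable {d : ℕ} (N : ℕ)

/-! ## §7 THE ROW-D1 END WITH an1's TYPED SHIFT: (Dspr)(Dnull) DISCHARGED, hW-side letters = (V-d) + (Wd) only — and with (V-d) REPLACED BY (S-V)⁰⁴ -/

section End

variable {Lc : ℕ} [NeZero Lc]

open Literature.MathematicalPhysics.QuantumFieldTheory.Balaban1983to89.Beta.VectorTailsLoc (fam kfam) in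
open Literature.MathematicalPhysics.QuantumFieldTheory.Balaban1983to89.Beta.VectorLegVolumeAdapter (MvE) in
open ExpKernelCalculus (BiLoc tr tadpole shiftK) in
open PolarizationSign (reflSign WardTransversal AxisReflectionCovariant) in
open KernelReflection (refK) in
open ResolventReflection (bref Φ) in
open OneStepResolventKernel (LocStencil JetData) in
open OneStepKernelFamily (KInvStep vertexOfK TbalOf flipK D1Tel D1Rep D1Drift) in
open B6BondElimination (unitVec) in
open KernelWard (divV divW) in
open Summit.QuantumFields.BalabanUV.Beta.ChartConjugation (conjV conjW) in
open Summit.QuantumFields.BalabanUV.Beta.ChartConjugationDefectEnd (conjDefect) in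
open Summit.QuantumFields.BalabanUV.Beta.SymmetrisedDressingKernel (coDressKSymAt) in
open Summit.QuantumFields.BalabanUV.Beta.AveragingWardRootedStencils (legInd) in
open Summit.QuantumFields.BalabanUV.Beta.SymmetrisedStepJets (SymTables JsB12Sym0 JsB12Sym) in
open Summit.QuantumFields.BalabanUV.Beta.SymShiftedSpread (bhKStepSh) in
open Summit.QuantumFields.BalabanUV.Beta.BorderedHessian (sgnK bhKStep stepScale diagK) in
open Summit.QuantumFields.BalabanUV.Beta.RowD1JointEndSym (d1Drift_JsB12Sym_of_shiftLetters_D1Tel_D1Rep) in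
/-- **ROW D1 — THE LITERAL ROOT `D1Drift Lc (JsB12Sym hLc N tabs cΛ cB) Nc μ ν` AT an1's TYPED SHIFT `Dsh Lc`**: the END
`RowD1JointEndSym.d1Drift_JsB12Sym_of_shiftLetters_D1Tel_D1Rep` instantiated at `Dsh := DshAn1.Dsh Lc` with its letters (Dspr) ∕ (Dnull) DISCHARGED by
`spr_Dsh` ∕ `comp_comp_symEc_Dsh_symEc`; displayed on the hW side: ONLY the border letter (V-d) of `tabs.V` (now against a TYPED, non-zero `Dsh`) and (Wd).
HONEST: composition by name; 0∕5 root-level classes; tables 0∕5; NOT D1. -/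
theorem d1Drift_JsB12Sym_of_an1Shift_D1Tel_D1Rep (hLc : Odd Lc) (hL2 : 2 ≤ Lc) (N : ℕ) (tabs : SymTables 3 Lc) (cΛ cB : ℝ)
    -- R-D1-g28-1 with an1's TYPED shift `Dsh Lc`: ONLY the border letter (V-d) of `tabs.V` ((Dspr)(Dnull) are theorems, §4–§5)
    (hVd : ∀ u : Fin 4 → ℤ, conjV (bhK Lc + Dsh Lc) (diagK (legInd (ctr 4 Lc) u)) =
      conjV (ffK (bhK (d := 3) Lc)) (diagK (legInd (ctr 4 Lc) u)) - ((Lc : ℝ) ^ 4) • divV tabs.V u)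
    -- hW: the second-order Ward letter with the PINNED generator
    (X₂w Nr : ℕ → (Fin 4 → ℤ) → Fin 4 → (Fin 4 → ℤ) → MKer 4 (Fib 3)) (hX₂w : ∀ j y ν y', Loc (X₂w j y ν y'))
    (hNr : ∀ j y ν y', Loc (Nr j y ν y')) (hEX₂w : ∀ j y ν y', comp (symEc Lc) (X₂w j y ν y') = comp (X₂w j y ν y') (symEc Lc))
    (hWd : ∀ (j : ℕ) (y : Fin 4 → ℤ) (ν : Fin 4) (y' : Fin 4 → ℤ),
      divW (JsB12Sym0 hLc N tabs cΛ cB j).W y ν y' =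
        conjW (bhKStepSh 3 Lc (Dsh Lc) j) 0 (vertexOfK (coDressKSymAt (toSite (ctrOff 4 Lc)) Lc (KInvStep (d := 3) Lc j)) Lc (JsB12Sym0 hLc N tabs cΛ cB j).S ν y')
          (diagK ((1 / 2 : ℝ) • ∑ v ∈ box 4 Lc, legInd (ctr 4 Lc) ((Lc : ℤ) • y + toSite v))) 0 (X₂w j y ν y') + Nr j y ν y')
    (hNt : ∀ j y ν y', trK (Nr j y ν y') = -sgnK (Nr j y ν y'))
    -- hR ∧ hSX: the compensated letters against `bhKStepSh 3 Lc (Dsh Lc) j`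
    (C : ℕ → Fin 4 → Fin 4 → (Fin 4 → ℤ) → MKer 4 (Fib 3)) (Cc δc : ℕ → ℝ) (hC : ∀ j α, LocStencil (C j α) (Cc j) (δc j))
    (hδc : ∀ j, 0 < δc j) (X₂ Wc : ℕ → Fin 4 → Fin 4 → (Fin 4 → ℤ) → Fin 4 → (Fin 4 → ℤ) → MKer 4 (Fib 3))
    (hX₂ : ∀ j α μ y ν y', Loc (X₂ j α μ y ν y')) (hWc : ∀ j α μ y ν y', Loc (Wc j α μ y ν y'))
    (hSrC : ∀ (j : ℕ) (α κ' : Fin 4) (u : Fin 4 → ℤ),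
      (JsB12Sym0 hLc N tabs cΛ cB j).S κ' (bref α κ' u) =
        reflSign α κ' • refK (Φ Lc α) ((JsB12Sym0 hLc N tabs cΛ cB j).S κ' u + conjV (bhKStepSh 3 Lc (Dsh Lc) j) (C j α κ' u)))
    (hWrC : ∀ (j : ℕ) (α μ : Fin 4) (y : Fin 4 → ℤ) (ν : Fin 4) (y' : Fin 4 → ℤ),
      (JsB12Sym0 hLc N tabs cΛ cB j).W μ (bref α μ y) ν (bref α ν y') = (reflSign α μ * reflSign α ν) • refK (Φ Lc α) ((JsB12Sym0 hLc N tabs cΛ cB j).W μ y ν y' +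
        conjW (bhKStepSh 3 Lc (Dsh Lc) j) (vertexOfK (coDressKSymAt (toSite (ctrOff 4 Lc)) Lc (KInvStep (d := 3) Lc j)) Lc (JsB12Sym0 hLc N tabs cΛ cB j).S μ y)
          (vertexOfK (coDressKSymAt (toSite (ctrOff 4 Lc)) Lc (KInvStep (d := 3) Lc j)) Lc (JsB12Sym0 hLc N tabs cΛ cB j).S ν y')
          (vertexOfK (coDressKSymAt (toSite (ctrOff 4 Lc)) Lc (KInvStep (d := 3) Lc j)) Lc (C j α) μ y)
          (vertexOfK (coDressKSymAt (toSite (ctrOff 4 Lc)) Lc (KInvStep (d := 3) Lc j)) Lc (C j α) ν y') (X₂ j α μ y ν y')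
          + Wc j α μ y ν y'))
    (hcomp : ∀ (j : ℕ) (α μ : Fin 4) (y : Fin 4 → ℤ) (ν : Fin 4) (y' : Fin 4 → ℤ),
      (1 / 2 : ℝ) * tadpole (coDressKSymAt (toSite (ctrOff 4 Lc)) Lc (KInvStep (d := 3) Lc j)) (Wc j α μ y ν y')
        + conjDefect (coDressKSymAt (toSite (ctrOff 4 Lc)) Lc (KInvStep (d := 3) Lc j)) (bhKStepSh 3 Lc (Dsh Lc) j)
            (vertexOfK (coDressKSymAt (toSite (ctrOff 4 Lc)) Lc (KInvStep (d := 3) Lc j)) Lc (JsB12Sym0 hLc N tabs cΛ cB j).S μ y)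
            (vertexOfK (coDressKSymAt (toSite (ctrOff 4 Lc)) Lc (KInvStep (d := 3) Lc j)) Lc (JsB12Sym0 hLc N tabs cΛ cB j).S ν y')
            (vertexOfK (coDressKSymAt (toSite (ctrOff 4 Lc)) Lc (KInvStep (d := 3) Lc j)) Lc (C j α) μ y)
            (vertexOfK (coDressKSymAt (toSite (ctrOff 4 Lc)) Lc (KInvStep (d := 3) Lc j)) Lc (C j α) ν y') (X₂ j α μ y ν y') = 0)
    -- the route theorem's own binders, verbatim
    (a : ℝ) (ha : 0 < a)
    (h12 : B5.Prop12Printed (fam (fun i : ℕ+ × ℕ => ((i.1 : ℕ+) : ℕ)) (fun i => i.1.pos) MvE a ha))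
    (h126 : B5.Kernel126_127Printed (kfam (fun i : ℕ+ × ℕ => ((i.1 : ℕ+) : ℕ)) MvE))
    {L : Type*} {SL : Finset L} (hSL : SL.Nonempty) (k : L → Fin 4) {μ ν : Fin 4} (hμν : μ ≠ ν) {Nc : ℝ} (hNc : Nc ≠ 0)
    (Jc : ∀ m : ℕ, JetData 3 (Lc ^ m))
    (htel : D1Tel Lc (JsB12Sym hLc N tabs cΛ cB) Jc)
    {cc : ℝ} {Mw' : ℕ → ℕ} (hc : 1 ≤ cc) (hMwin : ∀ L : ℕ, 2 ≤ L → 1 ≤ Mw' L ∧ (L : ℝ) ≤ cc * Mw' L) (hML : ∀ L : ℕ, 2 ≤ L → Mw' L ≤ L)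
    (hrep : D1Rep Lc Jc Nc μ ν a SL k) :
    D1Drift Lc (JsB12Sym hLc N tabs cΛ cB) Nc μ ν :=
  d1Drift_JsB12Sym_of_shiftLetters_D1Tel_D1Rep hLc hL2 N tabs cΛ cB (Dsh Lc) (spr_Dsh (one_le_of_neZero Lc))
    (comp_comp_symEc_Dsh_symEc (one_le_of_neZero Lc)) hVd X₂w Nr hX₂w hNr hEX₂w hWd hNt C Cc δc hC hδc X₂ Wc hX₂ hWc hSrC hWrC hcomp
    a ha h12 h126 hSL k hμν hNc Jc htel hc hMwin hML hrep

open Literature.MathematicalPhysics.QuantumFieldTheory.Balaban1983to89.Beta.VectorTailsLoc (fam kfam) in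
open Literature.MathematicalPhysics.QuantumFieldTheory.Balaban1983to89.Beta.VectorLegVolumeAdapter (MvE) in
open ExpKernelCalculus (BiLoc tr tadpole shiftK) in
open PolarizationSign (reflSign WardTransversal AxisReflectionCovariant) in
open KernelReflection (refK) in
open ResolventReflection (bref Φ) in
open OneStepResolventKernel (LocStencil JetData) in
open OneStepKernelFamily (KInvStep vertexOfK TbalOf flipK D1Tel D1Rep D1Drift) in
open B6BondElimination (unitVec) in
open KernelWard (divV divW) in
open Summit.QuantumFields.BalabanUV.Beta.ChartConjugation (conjV conjW) in
open Summit.QuantumFields.BalabanUV.Beta.ChartConjugationDefectEnd (conjDefect) in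
open Summit.QuantumFields.BalabanUV.Beta.SymmetrisedDressingKernel (coDressKSymAt) in
open Summit.QuantumFields.BalabanUV.Beta.AveragingWardRootedStencils (legInd) in
open Summit.QuantumFields.BalabanUV.Beta.SymmetrisedStepJets (SymTables JsB12Sym0 JsB12Sym) in
open Summit.QuantumFields.BalabanUV.Beta.SymShiftedSpread (bhKStepSh) in
open Summit.QuantumFields.BalabanUV.Beta.BorderedHessian (sgnK bhKStep stepScale diagK) in
open StepJetData (mfNeg) in
/-- **ROW D1 — THE LITERAL ROOT AT an1's TYPED SHIFT WITH THE BORDER LETTER IN WARD FORM**: as `d1Drift_JsB12Sym_of_an1Shift_D1Tel_D1Rep`, the letter (V-d)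
REPLACED by the (0.4) stencil Ward law **(S-V)⁰⁴ `∀ u, divV tabs.V u = conjV (mfNeg (linSym04At ρ_c Lc)) (diagK (legInd ρ_c u))`** of the border table ALONE
(`hVd_iff`) — the literal twin of an2's THEOREM `divV_vhSAt_eq_conjV` for the comb table.  Displayed hW-side letters: (S-V)⁰⁴ of `tabs.V`, (Wd).  HONEST: (S-V)⁰⁴ is a
letter about an1's VALUES `tabs.V` (not minted here: TABLES-SYM F0 ∕ C-d1ref44-6); composition by name; 0∕5 root-level classes; tables 0∕5; NOT D1. -/
theorem d1Drift_JsB12Sym_of_an1Shift_wardV_D1Tel_D1Rep (hLc : Odd Lc) (hL2 : 2 ≤ Lc) (N : ℕ) (tabs : SymTables 3 Lc) (cΛ cB : ℝ)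
    -- (S-V)⁰⁴: the (0.4) stencil Ward law of the border table `tabs.V` (≡ (V-d) against the typed shift, `hVd_iff`)
    (hVd04 : ∀ u : Fin 4 → ℤ, divV tabs.V u = conjV (mfNeg (linSym04At (ctr 4 Lc) Lc)) (diagK (legInd (ctr 4 Lc) u)))
    -- hW: the second-order Ward letter with the PINNED generator
    (X₂w Nr : ℕ → (Fin 4 → ℤ) → Fin 4 → (Fin 4 → ℤ) → MKer 4 (Fib 3)) (hX₂w : ∀ j y ν y', Loc (X₂w j y ν y'))
    (hNr : ∀ j y ν y', Loc (Nr j y ν y')) (hEX₂w : ∀ j y ν y', comp (symEc Lc) (X₂w j y ν y') = comp (X₂w j y ν y') (symEc Lc))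
    (hWd : ∀ (j : ℕ) (y : Fin 4 → ℤ) (ν : Fin 4) (y' : Fin 4 → ℤ),
      divW (JsB12Sym0 hLc N tabs cΛ cB j).W y ν y' =
        conjW (bhKStepSh 3 Lc (Dsh Lc) j) 0 (vertexOfK (coDressKSymAt (toSite (ctrOff 4 Lc)) Lc (KInvStep (d := 3) Lc j)) Lc (JsB12Sym0 hLc N tabs cΛ cB j).S ν y')
          (diagK ((1 / 2 : ℝ) • ∑ v ∈ box 4 Lc, legInd (ctr 4 Lc) ((Lc : ℤ) • y + toSite v))) 0 (X₂w j y ν y') + Nr j y ν y')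
    (hNt : ∀ j y ν y', trK (Nr j y ν y') = -sgnK (Nr j y ν y'))
    -- hR ∧ hSX: the compensated letters against `bhKStepSh 3 Lc (Dsh Lc) j`
    (C : ℕ → Fin 4 → Fin 4 → (Fin 4 → ℤ) → MKer 4 (Fib 3)) (Cc δc : ℕ → ℝ) (hC : ∀ j α, LocStencil (C j α) (Cc j) (δc j))
    (hδc : ∀ j, 0 < δc j) (X₂ Wc : ℕ → Fin 4 → Fin 4 → (Fin 4 → ℤ) → Fin 4 → (Fin 4 → ℤ) → MKer 4 (Fib 3))
    (hX₂ : ∀ j α μ y ν y', Loc (X₂ j α μ y ν y')) (hWc : ∀ j α μ y ν y', Loc (Wc j α μ y ν y'))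
    (hSrC : ∀ (j : ℕ) (α κ' : Fin 4) (u : Fin 4 → ℤ),
      (JsB12Sym0 hLc N tabs cΛ cB j).S κ' (bref α κ' u) =
        reflSign α κ' • refK (Φ Lc α) ((JsB12Sym0 hLc N tabs cΛ cB j).S κ' u + conjV (bhKStepSh 3 Lc (Dsh Lc) j) (C j α κ' u)))
    (hWrC : ∀ (j : ℕ) (α μ : Fin 4) (y : Fin 4 → ℤ) (ν : Fin 4) (y' : Fin 4 → ℤ),
      (JsB12Sym0 hLc N tabs cΛ cB j).W μ (bref α μ y) ν (bref α ν y') = (reflSign α μ * reflSign α ν) • refK (Φ Lc α) ((JsB12Sym0 hLc N tabs cΛ cB j).W μ y ν y' +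
        conjW (bhKStepSh 3 Lc (Dsh Lc) j) (vertexOfK (coDressKSymAt (toSite (ctrOff 4 Lc)) Lc (KInvStep (d := 3) Lc j)) Lc (JsB12Sym0 hLc N tabs cΛ cB j).S μ y)
          (vertexOfK (coDressKSymAt (toSite (ctrOff 4 Lc)) Lc (KInvStep (d := 3) Lc j)) Lc (JsB12Sym0 hLc N tabs cΛ cB j).S ν y')
          (vertexOfK (coDressKSymAt (toSite (ctrOff 4 Lc)) Lc (KInvStep (d := 3) Lc j)) Lc (C j α) μ y)
          (vertexOfK (coDressKSymAt (toSite (ctrOff 4 Lc)) Lc (KInvStep (d := 3) Lc j)) Lc (C j α) ν y') (X₂ j α μ y ν y')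
          + Wc j α μ y ν y'))
    (hcomp : ∀ (j : ℕ) (α μ : Fin 4) (y : Fin 4 → ℤ) (ν : Fin 4) (y' : Fin 4 → ℤ),
      (1 / 2 : ℝ) * tadpole (coDressKSymAt (toSite (ctrOff 4 Lc)) Lc (KInvStep (d := 3) Lc j)) (Wc j α μ y ν y')
        + conjDefect (coDressKSymAt (toSite (ctrOff 4 Lc)) Lc (KInvStep (d := 3) Lc j)) (bhKStepSh 3 Lc (Dsh Lc) j)
            (vertexOfK (coDressKSymAt (toSite (ctrOff 4 Lc)) Lc (KInvStep (d := 3) Lc j)) Lc (JsB12Sym0 hLc N tabs cΛ cB j).S μ y)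
            (vertexOfK (coDressKSymAt (toSite (ctrOff 4 Lc)) Lc (KInvStep (d := 3) Lc j)) Lc (JsB12Sym0 hLc N tabs cΛ cB j).S ν y')
            (vertexOfK (coDressKSymAt (toSite (ctrOff 4 Lc)) Lc (KInvStep (d := 3) Lc j)) Lc (C j α) μ y)
            (vertexOfK (coDressKSymAt (toSite (ctrOff 4 Lc)) Lc (KInvStep (d := 3) Lc j)) Lc (C j α) ν y') (X₂ j α μ y ν y') = 0)
    -- the route theorem's own binders, verbatim
    (a : ℝ) (ha : 0 < a)
    (h12 : B5.Prop12Printed (fam (fun i : ℕ+ × ℕ => ((i.1 : ℕ+) : ℕ)) (fun i => i.1.pos) MvE a ha))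
    (h126 : B5.Kernel126_127Printed (kfam (fun i : ℕ+ × ℕ => ((i.1 : ℕ+) : ℕ)) MvE))
    {L : Type*} {SL : Finset L} (hSL : SL.Nonempty) (k : L → Fin 4) {μ ν : Fin 4} (hμν : μ ≠ ν) {Nc : ℝ} (hNc : Nc ≠ 0)
    (Jc : ∀ m : ℕ, JetData 3 (Lc ^ m))
    (htel : D1Tel Lc (JsB12Sym hLc N tabs cΛ cB) Jc)
    {cc : ℝ} {Mw' : ℕ → ℕ} (hc : 1 ≤ cc) (hMwin : ∀ L : ℕ, 2 ≤ L → 1 ≤ Mw' L ∧ (L : ℝ) ≤ cc * Mw' L) (hML : ∀ L : ℕ, 2 ≤ L → Mw' L ≤ L)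
    (hrep : D1Rep Lc Jc Nc μ ν a SL k) :
    D1Drift Lc (JsB12Sym hLc N tabs cΛ cB) Nc μ ν :=
  d1Drift_JsB12Sym_of_an1Shift_D1Tel_D1Rep hLc hL2 N tabs cΛ cB ((hVd_iff Lc (divV tabs.V)).2 hVd04) X₂w Nr hX₂w hNr hEX₂w hWd hNt C Cc δc hC
    hδc X₂ Wc hX₂ hWc hSrC hWrC hcomp a ha h12 h126 hSL k hμν hNc Jc htel hc hMwin hML hrep

end End


/-! ## §8 (row owner an2 gen 28) THE LITERAL ROOT AT an1's `Dsh Lc` WITH (St)(Wt)(Sd)(Sr-conj) DISCHARGED — every shift letter a theorem -/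

section EndRefl

variable {Lc : ℕ} [NeZero Lc]

open Summit.QuantumFields.BalabanUV.Beta.E3ContactGenerator (ctGenM ctGenM_inr) in
/-- [folklore] **THE FIRST-ORDER CONTACT GENERATOR OF RECORD AT an1's SHIFT IS an3's `ctGen⁰⁴`**: the multiplier leg of
`ctGenM d (bhK L + Dsh L) α L κ′ u` reads `−[μ = α]·[proj L z = 0]·lin04KerAt ρ_c L μ (z∕L) (κ′, u)` — an2's comb generator `ctGen` with
`linKerAt ↦ lin04KerAt` (`bhK_add_Dsh_inr_inl`; the field leg is `ctGen`'s verbatim by `ctGenM_inl`). -/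
theorem ctGenM_bhK_add_Dsh_inr {L : ℕ} [NeZero L] (α κ' : Fin (d + 1)) (u z : Fin (d + 1) → ℤ) (μ : Fin (d + 1)) :
    ctGenM d (bhK L + Dsh L) α L κ' u z (Sum.inr μ) =
      if μ = α ∧ Torus.proj L z = 0 then -lin04KerAt (ctr (d + 1) L) L μ (quo L z) (κ', u) else 0 := by
  classical
  simp only [ctGenM_inr, bhK_add_Dsh_inr_inl, lin04KerAt]
  by_cases hμ : μ = α <;> by_cases hz : Torus.proj L z = 0 <;> simp [hμ, hz]

open Literature.MathematicalPhysics.QuantumFieldTheory.Balaban1983to89.Beta.VectorTailsLoc (fam kfam) in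
open Literature.MathematicalPhysics.QuantumFieldTheory.Balaban1983to89.Beta.VectorLegVolumeAdapter (MvE) in
open ExpKernelCalculus (BiLoc tr tadpole shiftK) in
open PolarizationSign (reflSign WardTransversal AxisReflectionCovariant) in
open KernelReflection (refK) in
open ResolventReflection (bref Φ) in
open OneStepResolventKernel (LocStencil JetData) in
open OneStepKernelFamily (KInvStep vertexOfK TbalOf flipK D1Tel D1Rep D1Drift) in
open KernelWard (divV divW) in
open StepJetData (mfNeg) in
open BalabanStepJetsSucc (wVH) in
open Summit.QuantumFields.BalabanUV.Beta.ChartConjugation (conjV conjW) in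
open Summit.QuantumFields.BalabanUV.Beta.ChartConjugationDefectEnd (conjDefect) in
open Summit.QuantumFields.BalabanUV.Beta.SymmetrisedDressingKernel (coDressKSymAt) in
open Summit.QuantumFields.BalabanUV.Beta.AveragingWardRootedStencils (legInd) in
open Summit.QuantumFields.BalabanUV.Beta.SymmetrisedStepJets (SymTables Gsym JsB12Sym0 JsB12Sym) in
open Summit.QuantumFields.BalabanUV.Beta.SymShiftedSpread (bhKStepSh) in
open Summit.QuantumFields.BalabanUV.Beta.BorderedHessian (sgnK bhKStep stepScale diagK) in
open Summit.QuantumFields.BalabanUV.Beta.E3ContactGenerator (ctGenM) in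
open Summit.QuantumFields.BalabanUV.Beta.SymShiftGaugeBlind (comp_Gsym_Dsh_inr_inl_of_grad comp_Dsh_Gsym_inl_inr_of_grad) in
open Summit.QuantumFields.BalabanUV.Beta.RowD1JointEndSym (d1Drift_JsB12Sym_of_reflLetters_D1Tel_D1Rep) in
/-- **ROW D1 — THE LITERAL ROOT `D1Drift Lc (JsB12Sym hLc N tabs cΛ cB) Nc μ ν` AT an1's TYPED SHIFT `Dsh Lc`, BOTH FIRST-ORDER LETTERS DISCHARGED** (row owner an2
gen 28, on an1 gen 38's datum): `RowD1JointEndSym.d1Drift_JsB12Sym_of_reflLetters_D1Tel_D1Rep` (p259022) at `Dsh := DshAn1.Dsh Lc` with EVERY shift letter a THEOREM —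
(Dspr) `spr_Dsh`, (Dnull) `comp_comp_symEc_Dsh_symEc`, (Dff) `Dsh_inl_inl`, (Dmm) `Dsh_inr_inr`, (DG) by `SymShiftGaugeBlind` from (Dgrad) `Dsh_inl_inr_eq_sub` +
`lam04_eq_zero_of_ne_blk` and (Dskew) `Dsh_inr_inl_eq_neg` — and (V-d) traded for the TABLE Ward law (S-V)⁰⁴ by `hVd_iff`.  Displayed: `tabs`; (S-V)⁰⁴; (Wd) with the pinned
Ward generator, `X₂ʷ`, `Nr`; the tables' reflection letters (V-r) (three border leg pairs, against `bhK Lc + Dsh Lc`, generator `ctGenM 3 (bhK Lc + Dsh Lc)` — an3's `ctGen⁰⁴`),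
(V-ff0), (H-r); `γ` with its defining equation; (Wr-conj-c) with the pinned first-order contacts, `X₂`, `Wc`; `hcomp`; `D1Tel`; `D1Rep`; `h12`∕`h126`; the window.
HONEST: composition by name; 0∕5 root-level classes (hW-letters = (S-V)⁰⁴(Wd); hR-letters = (V-r)(V-ff0)(H-r)(Wr-conj-c)); tables 0∕5; NOT D1. -/
theorem d1Drift_JsB12Sym_of_an1Shift_reflLetters_D1Tel_D1Rep (hLc : Odd Lc) (hL2 : 2 ≤ Lc) (N : ℕ) (tabs : SymTables 3 Lc) (cΛ cB : ℝ)
    -- hW, first order: the (0.4) stencil Ward law of `tabs.V` ((S-V)⁰⁴, an1's `hVd_iff` form of (V-d))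
    (hVd04 : ∀ u : Fin 4 → ℤ, divV tabs.V u = conjV (mfNeg (linSym04At (ctr 4 Lc) Lc)) (diagK (legInd (ctr 4 Lc) u)))
    -- hW: the second-order Ward letter with the PINNED Ward generator
    (X₂w Nr : ℕ → (Fin 4 → ℤ) → Fin 4 → (Fin 4 → ℤ) → MKer 4 (Fib 3)) (hX₂w : ∀ j y ν y', Loc (X₂w j y ν y'))
    (hNr : ∀ j y ν y', Loc (Nr j y ν y')) (hEX₂w : ∀ j y ν y', comp (symEc Lc) (X₂w j y ν y') = comp (X₂w j y ν y') (symEc Lc))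
    (hWd : ∀ (j : ℕ) (y : Fin 4 → ℤ) (ν : Fin 4) (y' : Fin 4 → ℤ),
      divW (JsB12Sym0 hLc N tabs cΛ cB j).W y ν y' =
        conjW (bhKStepSh 3 Lc (Dsh Lc) j) 0 (vertexOfK (coDressKSymAt (toSite (ctrOff 4 Lc)) Lc (KInvStep (d := 3) Lc j)) Lc (JsB12Sym0 hLc N tabs cΛ cB j).S ν y')
          (diagK ((1 / 2 : ℝ) • ∑ v ∈ box 4 Lc, legInd (ctr 4 Lc) ((Lc : ℤ) • y + toSite v))) 0 (X₂w j y ν y') + Nr j y ν y')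
    (hNt : ∀ j y ν y', trK (Nr j y ν y') = -sgnK (Nr j y ν y'))
    -- hR, first order: the tables' REFLECTION letters (V-r)(V-ff0)(H-r)
    (hVfm : ∀ (α κ' : Fin 4) (u x z : Fin 4 → ℤ) (β m : Fin 4), tabs.V κ' (bref α κ' u) x z (Sum.inl β) (Sum.inr m) =
      (reflSign α κ' • refK (Φ (d := 3) Lc α) (tabs.V κ' u + conjV (bhK (d := 3) Lc + Dsh Lc)
        ((((Lc : ℝ) ^ 4)⁻¹) • diagK (ctGenM 3 (bhK Lc + Dsh Lc) α Lc κ' u)))) x z (Sum.inl β) (Sum.inr m))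
    (hVmf : ∀ (α κ' : Fin 4) (u x z : Fin 4 → ℤ) (m β : Fin 4), tabs.V κ' (bref α κ' u) x z (Sum.inr m) (Sum.inl β) =
      (reflSign α κ' • refK (Φ (d := 3) Lc α) (tabs.V κ' u + conjV (bhK (d := 3) Lc + Dsh Lc)
        ((((Lc : ℝ) ^ 4)⁻¹) • diagK (ctGenM 3 (bhK Lc + Dsh Lc) α Lc κ' u)))) x z (Sum.inr m) (Sum.inl β))
    (hVmm : ∀ (α κ' : Fin 4) (u x z : Fin 4 → ℤ) (m m' : Fin 4), tabs.V κ' (bref α κ' u) x z (Sum.inr m) (Sum.inr m') =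
      (reflSign α κ' • refK (Φ (d := 3) Lc α) (tabs.V κ' u + conjV (bhK (d := 3) Lc + Dsh Lc)
        ((((Lc : ℝ) ^ 4)⁻¹) • diagK (ctGenM 3 (bhK Lc + Dsh Lc) α Lc κ' u)))) x z (Sum.inr m) (Sum.inr m'))
    (hV0 : ∀ (κ : Fin 4) (w x z : Fin 4 → ℤ) (β β' : Fin 4), tabs.V κ w x z (Sum.inl β) (Sum.inl β') = 0)
    (hHr : ∀ (α μ : Fin 4) (y : Fin 4 → ℤ), tabs.H μ (bref α μ y) = reflSign α μ • refK (Φ (d := 3) Lc α) (tabs.H μ y))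
    -- the first-order contact coefficient, displayed
    (γ : ℕ → ℝ) (hγ : ∀ j, γ j = -((Lc : ℝ) ^ 8 / 2) * wVH 3 Lc j / (stepScale 3 Lc j * (Lc : ℝ) ^ 4))
    -- hR, second order, with the PINNED first-order contacts
    (X₂ Wc : ℕ → Fin 4 → Fin 4 → (Fin 4 → ℤ) → Fin 4 → (Fin 4 → ℤ) → MKer 4 (Fib 3))
    (hX₂ : ∀ j α μ y ν y', Loc (X₂ j α μ y ν y')) (hWc : ∀ j α μ y ν y', Loc (Wc j α μ y ν y'))
    (hWrC : ∀ (j : ℕ) (α μ : Fin 4) (y : Fin 4 → ℤ) (ν : Fin 4) (y' : Fin 4 → ℤ),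
      (JsB12Sym0 hLc N tabs cΛ cB j).W μ (bref α μ y) ν (bref α ν y') = (reflSign α μ * reflSign α ν) • refK (Φ Lc α) ((JsB12Sym0 hLc N tabs cΛ cB j).W μ y ν y' +
        conjW (bhKStepSh 3 Lc (Dsh Lc) j) (vertexOfK (coDressKSymAt (toSite (ctrOff 4 Lc)) Lc (KInvStep (d := 3) Lc j)) Lc (JsB12Sym0 hLc N tabs cΛ cB j).S μ y)
          (vertexOfK (coDressKSymAt (toSite (ctrOff 4 Lc)) Lc (KInvStep (d := 3) Lc j)) Lc (JsB12Sym0 hLc N tabs cΛ cB j).S ν y')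
          (vertexOfK (coDressKSymAt (toSite (ctrOff 4 Lc)) Lc (KInvStep (d := 3) Lc j)) Lc (fun κ u => γ j • diagK (ctGenM 3 (bhK Lc + Dsh Lc) α Lc κ u)) μ y)
          (vertexOfK (coDressKSymAt (toSite (ctrOff 4 Lc)) Lc (KInvStep (d := 3) Lc j)) Lc (fun κ u => γ j • diagK (ctGenM 3 (bhK Lc + Dsh Lc) α Lc κ u)) ν y')
          (X₂ j α μ y ν y')
          + Wc j α μ y ν y'))
    (hcomp : ∀ (j : ℕ) (α μ : Fin 4) (y : Fin 4 → ℤ) (ν : Fin 4) (y' : Fin 4 → ℤ),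
      (1 / 2 : ℝ) * tadpole (coDressKSymAt (toSite (ctrOff 4 Lc)) Lc (KInvStep (d := 3) Lc j)) (Wc j α μ y ν y')
        + conjDefect (coDressKSymAt (toSite (ctrOff 4 Lc)) Lc (KInvStep (d := 3) Lc j)) (bhKStepSh 3 Lc (Dsh Lc) j)
            (vertexOfK (coDressKSymAt (toSite (ctrOff 4 Lc)) Lc (KInvStep (d := 3) Lc j)) Lc (JsB12Sym0 hLc N tabs cΛ cB j).S μ y)
            (vertexOfK (coDressKSymAt (toSite (ctrOff 4 Lc)) Lc (KInvStep (d := 3) Lc j)) Lc (JsB12Sym0 hLc N tabs cΛ cB j).S ν y')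
            (vertexOfK (coDressKSymAt (toSite (ctrOff 4 Lc)) Lc (KInvStep (d := 3) Lc j)) Lc (fun κ u => γ j • diagK (ctGenM 3 (bhK Lc + Dsh Lc) α Lc κ u)) μ y)
            (vertexOfK (coDressKSymAt (toSite (ctrOff 4 Lc)) Lc (KInvStep (d := 3) Lc j)) Lc (fun κ u => γ j • diagK (ctGenM 3 (bhK Lc + Dsh Lc) α Lc κ u)) ν y')
            (X₂ j α μ y ν y') = 0)
    -- the route theorem's own binders, verbatim
    (a : ℝ) (ha : 0 < a)
    (h12 : B5.Prop12Printed (fam (fun i : ℕ+ × ℕ => ((i.1 : ℕ+) : ℕ)) (fun i => i.1.pos) MvE a ha))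
    (h126 : B5.Kernel126_127Printed (kfam (fun i : ℕ+ × ℕ => ((i.1 : ℕ+) : ℕ)) MvE))
    {L : Type*} {SL : Finset L} (hSL : SL.Nonempty) (k : L → Fin 4) {μ ν : Fin 4} (hμν : μ ≠ ν) {Nc : ℝ} (hNc : Nc ≠ 0)
    (Jc : ∀ m : ℕ, JetData 3 (Lc ^ m))
    (htel : D1Tel Lc (JsB12Sym hLc N tabs cΛ cB) Jc)
    {cc : ℝ} {Mw' : ℕ → ℕ} (hc : 1 ≤ cc) (hMwin : ∀ L : ℕ, 2 ≤ L → 1 ≤ Mw' L ∧ (L : ℝ) ≤ cc * Mw' L) (hML : ∀ L : ℕ, 2 ≤ L → Mw' L ≤ L)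
    (hrep : D1Rep Lc Jc Nc μ ν a SL k) :
    D1Drift Lc (JsB12Sym hLc N tabs cΛ cB) Nc μ ν := by
  have hLc1 : 1 ≤ Lc := one_le_of_neZero Lc
  have hDff : ∀ (x z : Fin 4 → ℤ) (β β' : Fin 4), Dsh Lc x z (Sum.inl β) (Sum.inl β') = 0 := fun x z β β' => Dsh_inl_inl Lc x z β β'
  have hDskew : ∀ (x z : Fin 4 → ℤ) (a' m : Fin 4), Dsh Lc x z (Sum.inl a') (Sum.inr m) = -Dsh Lc z x (Sum.inr m) (Sum.inl a') := fun x z a' m => by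
    rw [Dsh_inr_inl_eq_neg, neg_neg]
  have hDgrad : ∀ (z : Fin 4 → ℤ) (b : Fin 4), ∃ pot : (Fin 4 → ℤ) → ℝ, (Function.support pot).Finite ∧
      ∀ (x : Fin 4 → ℤ) (m : Fin 4), Torus.proj Lc x = 0 → Dsh Lc x z (Sum.inr m) (Sum.inl b) = pot (quo Lc x + unitVec m) - pot (quo Lc x) := fun z b =>
    ⟨fun Y => -lam04 Lc b z Y, (Set.finite_singleton (blk Lc z)).subset (fun Y hY => by
        by_contra hne
        apply hY
        show -lam04 Lc b z Y = 0
        rw [lam04_eq_zero_of_ne_blk hLc1 (fun h => hne (Set.mem_singleton_iff.mpr h)), neg_zero]),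
      fun x m hx => by rw [Dsh_inr_inl_eq_neg, Dsh_inl_inr_eq_sub, if_pos hx]; ring⟩
  exact d1Drift_JsB12Sym_of_reflLetters_D1Tel_D1Rep hLc hL2 N tabs cΛ cB (Dsh Lc) (spr_Dsh hLc1) (comp_comp_symEc_Dsh_symEc hLc1)
    ((hVd_iff Lc (divV tabs.V)).2 hVd04) hDff (fun x y κ l => Dsh_inr_inr Lc x y κ l)
    (fun j x z m b => comp_Gsym_Dsh_inr_inl_of_grad hDff hDgrad j x z m b) (fun j x z a' m => comp_Dsh_Gsym_inl_inr_of_grad hDff hDskew hDgrad j x z a' m)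
    X₂w Nr hX₂w hNr hEX₂w hWd hNt hVfm hVmf hVmm hV0 hHr γ hγ X₂ Wc hX₂ hWc hWrC hcomp a ha h12 h126 hSL k hμν hNc Jc htel hc hMwin hML hrep

end EndRefl

end Summit.QuantumFields.BalabanUV.Beta.DshAn1

end
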